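import Literature.Claims.NS.Otelbaev2013
import HarnessLib

/-!
# Barrier `AbstractAPrioriEstimateDirectSum` — per-space strengthening, part 1: the fixed `ℓ²` instance

Construction file (part 1 of 2) for the PER-SPACE form of the catalogue entry
`Literature.Barriers.NavierStokesRegularity.AbstractAPrioriEstimateDirectSum` (T2-a «dimension-uniform
abstract a priori estimate», cell ns-claims, claim C01 `Otelbaev2013`): «sup»'s original 2014
counterexample [cite: DxdyTopic80156, post 817605 (2014-01-21)] lives in ONE fixed infinite-dimensional
Hilbert space `Ĥ = ℓ₂` and defeats Theorem 6.1 even in the charitable reading in which the constants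
`(C₁, l)` may depend on the space (the cell's `Literature.Claims.NS.Otelbaev2013.Theorem61PerSpace`,
referee ns-claims-ref-1's RETYPE R#b, REF C01 2026-08-26T20:29:59Z «survives no»). Here, in
`ℓ²(Idx, ℝ)` with `Idx = Fin 50 ⊕ (ℕ × Bool)` (ground modes ⊕ blocks): eigenvalues `1` (×50), `50 + 2n`,
`51 + 2n`; `L(u,v) = Σ_n (u_{n,f} v_{n,t}/w_n)(e_{n,f} + e_{n,t})`, `w_n = n + 25`; typed as an
`Otelbaev2013.Setting` over Mathlib's `lp` with the standard `HilbertBasis`; (У.2), (У.3), (У.4), (У.5) (all `n' ≥ 0`, `C_P > 0`; `L_P ≡ 0`) are PROVED here (`S2_y2` … `S2_y5`);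
(У.1) with `(β, C_β) = (−1/2, 4)` (`S2_y1`) opens part 2. Part 2 (`AbstractAPrioriEstimateDirectSumPerSpace.lean`): the witnesses `ů_n`,
the entry `AbstractAPrioriEstimateDirectSumPerSpace`, its discharge, and
`not_otelbaev2013_theorem61PerSpace : ¬ Theorem61PerSpace`. Everything PROVED; no named fact.

(У.1) is proved by TERMWISE domination `(L u v)_i² ≤ 8‖A^{-1/2}v‖² (A^{-1/2}u)_i² + 8‖A^{-1/2}u‖²
(A^{-1/2}v)_i²` summed over `ℓ²` — no re-indexing of the direct sum is needed.

WHAT THIS IS NOT: not a claim about NS regularity or blow-up; not a claim about any author beyond the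
typed locator.
-/

noncomputable section
open scoped RealInnerProductSpace ENNReal
open Literature.Claims.NS.Otelbaev2013 Set Function

namespace Literature.Barriers.NavierStokesRegularity

namespace AbstractAPrioriEstimateDirectSumPerSpace


/-- Index type of the fixed infinite-dimensional instance: `50` ground modes `⊕` blocks `(n, b)`, `n ∈ ℕ`, `b ∈ Bool` (sup's pairs `(e_{2n}, e_{2n+1})`). [folklore] -/
abbrev Idx : Type := Fin 50 ⊕ (ℕ × Bool)

/-- The space `Ĥ = ℓ²(Idx, ℝ)` (Mathlib `lp _ 2`), a separable infinite-dimensional real Hilbert space. [folklore] -/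
abbrev H2 : Type := lp (fun _ : Idx => ℝ) 2

/-- The standard Hilbert basis of `ℓ²(Idx, ℝ)` (`HilbertBasis.ofRepr (refl)`, vectors `lp.single 2 i 1`). [folklore] -/
def stdBasis : HilbertBasis Idx ℝ H2 := HilbertBasis.ofRepr (LinearIsometryEquiv.refl ℝ _)

/-- `inner_stdBasis` — coordinate computation for sup's 2014 `ℓ₂` countermodel to Otelbaev's Theorem 6.1 (all blocks at once, one fixed infinite-dimensional space). [cite: DxdyTopic80156, post 817605 (2014-01-21)] -/
theorem inner_stdBasis (i : Idx) (u : H2) : ⟪stdBasis i, u⟫ = u i := by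
  rw [← HilbertBasis.repr_apply_apply]; rfl

/-- `abs_apply_le_norm` — coordinate computation for sup's 2014 `ℓ₂` countermodel to Otelbaev's Theorem 6.1 (all blocks at once, one fixed infinite-dimensional space). [cite: DxdyTopic80156, post 817605 (2014-01-21)] -/
theorem abs_apply_le_norm (u : H2) (i : Idx) : |u i| ≤ ‖u‖ := by
  simpa using lp.norm_apply_le_norm (p := 2) (by norm_num) u i

/-- `norm_sq_eq_tsum` — coordinate computation for sup's 2014 `ℓ₂` countermodel to Otelbaev's Theorem 6.1 (all blocks at once, one fixed infinite-dimensional space). [cite: DxdyTopic80156, post 817605 (2014-01-21)] -/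
theorem norm_sq_eq_tsum (u : H2) : ‖u‖ ^ 2 = ∑' i, (u i) ^ 2 := by
  have h := lp.norm_rpow_eq_tsum (p := 2) (by norm_num : 0 < (2 : ℝ≥0∞).toReal) u
  simp only [ENNReal.toReal_ofNat, Real.rpow_two] at h
  rw [h]; congr 1; ext i; rw [Real.norm_eq_abs, sq_abs]

/-- `summable_sq` — coordinate computation for sup's 2014 `ℓ₂` countermodel to Otelbaev's Theorem 6.1 (all blocks at once, one fixed infinite-dimensional space). [cite: DxdyTopic80156, post 817605 (2014-01-21)] -/
theorem summable_sq (u : H2) : Summable fun i => (u i) ^ 2 := by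
  have h := lp.memℓp u
  rw [memℓp_gen_iff (by norm_num)] at h
  simp only [ENNReal.toReal_ofNat, Real.rpow_two] at h
  refine h.congr fun i => ?_
  rw [Real.norm_eq_abs, sq_abs]

/-- Block weight `w_n = n + 25` (sup's «`n ≥ 25`»). [folklore] -/
def wt (n : ℕ) : ℝ := n + 25

/-- Coefficient of block `n` in `L(u,v)`: `u_{n,f} v_{n,t} / w_n`. [folklore] -/
def coef (u v : H2) (n : ℕ) : ℝ := u (Sum.inr (n, false)) * v (Sum.inr (n, true)) / wt n

/-- The raw coordinate function of `L(u,v)`: `0` on ground modes, `coef u v n` on both indices of block `n`. [folklore] -/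
def Lfun (u v : H2) : Idx → ℝ := fun i =>
  match i with
  | Sum.inl _ => 0
  | Sum.inr (n, _) => coef u v n

/-- `wt_pos` — coordinate computation for sup's 2014 `ℓ₂` countermodel to Otelbaev's Theorem 6.1 (all blocks at once, one fixed infinite-dimensional space). [cite: DxdyTopic80156, post 817605 (2014-01-21)] -/
theorem wt_pos (n : ℕ) : 0 < wt n := by unfold wt; positivity
/-- `one_le_wt` — coordinate computation for sup's 2014 `ℓ₂` countermodel to Otelbaev's Theorem 6.1 (all blocks at once, one fixed infinite-dimensional space). [cite: DxdyTopic80156, post 817605 (2014-01-21)] -/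
theorem one_le_wt (n : ℕ) : 1 ≤ wt n := by unfold wt; have : (0:ℝ) ≤ n := n.cast_nonneg; linarith

/-- `Lfun_sq_le` — coordinate computation for sup's 2014 `ℓ₂` countermodel to Otelbaev's Theorem 6.1 (all blocks at once, one fixed infinite-dimensional space). [cite: DxdyTopic80156, post 817605 (2014-01-21)] -/
theorem Lfun_sq_le (u v : H2) (i : Idx) :
    (Lfun u v i) ^ 2 ≤ ‖v‖ ^ 2 * (u i) ^ 2 + ‖u‖ ^ 2 * (v i) ^ 2 := by
  rcases i with k | ⟨n, b⟩
  · simp [Lfun]; positivity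
  · have hw := one_le_wt n
    have hc : (coef u v n) ^ 2 ≤ (u (Sum.inr (n, false)) * v (Sum.inr (n, true))) ^ 2 := by
      unfold coef
      rw [div_pow]
      exact div_le_self (sq_nonneg _) (by nlinarith)
    cases b
    · -- index (n,false): bound by ‖v‖² u_i²
      simp only [Lfun]
      have hv : (v (Sum.inr (n, true))) ^ 2 ≤ ‖v‖ ^ 2 := by
        have := abs_apply_le_norm v (Sum.inr (n, true))
        rw [← sq_abs]; exact pow_le_pow_left₀ (abs_nonneg _) this 2
      calc (coef u v n) ^ 2 ≤ (u (Sum.inr (n, false)) * v (Sum.inr (n, true))) ^ 2 := hc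
        _ = (v (Sum.inr (n, true))) ^ 2 * (u (Sum.inr (n, false))) ^ 2 := by ring
        _ ≤ ‖v‖ ^ 2 * (u (Sum.inr (n, false))) ^ 2 := by gcongr
        _ ≤ ‖v‖ ^ 2 * (u (Sum.inr (n, false))) ^ 2 + ‖u‖ ^ 2 * (v (Sum.inr (n, false))) ^ 2 := by
            have : 0 ≤ ‖u‖ ^ 2 * (v (Sum.inr (n, false))) ^ 2 := by positivity
            linarith
    · simp only [Lfun]
      have hu : (u (Sum.inr (n, false))) ^ 2 ≤ ‖u‖ ^ 2 := by
        have := abs_apply_le_norm u (Sum.inr (n, false))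
        rw [← sq_abs]; exact pow_le_pow_left₀ (abs_nonneg _) this 2
      calc (coef u v n) ^ 2 ≤ (u (Sum.inr (n, false)) * v (Sum.inr (n, true))) ^ 2 := hc
        _ = (u (Sum.inr (n, false))) ^ 2 * (v (Sum.inr (n, true))) ^ 2 := by ring
        _ ≤ ‖u‖ ^ 2 * (v (Sum.inr (n, true))) ^ 2 := by gcongr
        _ ≤ ‖v‖ ^ 2 * (u (Sum.inr (n, true))) ^ 2 + ‖u‖ ^ 2 * (v (Sum.inr (n, true))) ^ 2 := by
            have : 0 ≤ ‖v‖ ^ 2 * (u (Sum.inr (n, true))) ^ 2 := by positivity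
            linarith

/-- `memℓp_Lfun` — coordinate computation for sup's 2014 `ℓ₂` countermodel to Otelbaev's Theorem 6.1 (all blocks at once, one fixed infinite-dimensional space). [cite: DxdyTopic80156, post 817605 (2014-01-21)] -/
theorem memℓp_Lfun (u v : H2) : Memℓp (Lfun u v) 2 := by
  rw [memℓp_gen_iff (by norm_num)]
  simp only [ENNReal.toReal_ofNat, Real.rpow_two]
  have hdom : Summable fun i => ‖v‖ ^ 2 * (u i) ^ 2 + ‖u‖ ^ 2 * (v i) ^ 2 :=
    ((summable_sq u).mul_left _).add ((summable_sq v).mul_left _)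
  refine Summable.of_nonneg_of_le (fun i => by positivity) (fun i => ?_) hdom
  rw [Real.norm_eq_abs, sq_abs]
  exact Lfun_sq_le u v i

/-- `L(u,v)` as an element of `ℓ²` (square-summable by `Lfun_sq_le`). [folklore] -/
def Lvec (u v : H2) : H2 := ⟨Lfun u v, memℓp_Lfun u v⟩

/-- `Lvec_apply` — coordinate computation for sup's 2014 `ℓ₂` countermodel to Otelbaev's Theorem 6.1 (all blocks at once, one fixed infinite-dimensional space). [cite: DxdyTopic80156, post 817605 (2014-01-21)] -/
theorem Lvec_apply (u v : H2) (i : Idx) : Lvec u v i = Lfun u v i := rfl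

/-- `Lvec_inl` — coordinate computation for sup's 2014 `ℓ₂` countermodel to Otelbaev's Theorem 6.1 (all blocks at once, one fixed infinite-dimensional space). [cite: DxdyTopic80156, post 817605 (2014-01-21)] -/
theorem Lvec_inl (u v : H2) (k : Fin 50) : Lvec u v (Sum.inl k) = 0 := rfl
/-- `Lvec_inr` — coordinate computation for sup's 2014 `ℓ₂` countermodel to Otelbaev's Theorem 6.1 (all blocks at once, one fixed infinite-dimensional space). [cite: DxdyTopic80156, post 817605 (2014-01-21)] -/
theorem Lvec_inr (u v : H2) (n : ℕ) (b : Bool) : Lvec u v (Sum.inr (n, b)) = coef u v n := rfl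

/-- Eigenvalues: `1` on the ground modes (`dim G₁ = 50`), `50 + 2n` and `51 + 2n` on block `n` (simple spectrum `50 < 51 < 52 < …` above `λ₁ = 1`, `λ₂ = 50`). [folklore] -/
def eig2 : Idx → ℝ
  | Sum.inl _ => 1
  | Sum.inr (n, false) => 50 + 2 * n
  | Sum.inr (n, true) => 51 + 2 * n

/-- `eig2_inl` — coordinate computation for sup's 2014 `ℓ₂` countermodel to Otelbaev's Theorem 6.1 (all blocks at once, one fixed infinite-dimensional space). [cite: DxdyTopic80156, post 817605 (2014-01-21)] -/
theorem eig2_inl (k : Fin 50) : eig2 (Sum.inl k) = 1 := rfl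
/-- `eig2_f` — coordinate computation for sup's 2014 `ℓ₂` countermodel to Otelbaev's Theorem 6.1 (all blocks at once, one fixed infinite-dimensional space). [cite: DxdyTopic80156, post 817605 (2014-01-21)] -/
theorem eig2_f (n : ℕ) : eig2 (Sum.inr (n, false)) = 50 + 2 * n := rfl
/-- `eig2_t` — coordinate computation for sup's 2014 `ℓ₂` countermodel to Otelbaev's Theorem 6.1 (all blocks at once, one fixed infinite-dimensional space). [cite: DxdyTopic80156, post 817605 (2014-01-21)] -/
theorem eig2_t (n : ℕ) : eig2 (Sum.inr (n, true)) = 51 + 2 * n := rfl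

/-- `fifty_le_eig2_inr` — coordinate computation for sup's 2014 `ℓ₂` countermodel to Otelbaev's Theorem 6.1 (all blocks at once, one fixed infinite-dimensional space). [cite: DxdyTopic80156, post 817605 (2014-01-21)] -/
theorem fifty_le_eig2_inr (n : ℕ) (b : Bool) : 50 ≤ eig2 (Sum.inr (n, b)) := by
  have : (0 : ℝ) ≤ n := n.cast_nonneg
  cases b
  · rw [eig2_f]; linarith
  · rw [eig2_t]; linarith

/-- `eig2_inr_ne_one` — coordinate computation for sup's 2014 `ℓ₂` countermodel to Otelbaev's Theorem 6.1 (all blocks at once, one fixed infinite-dimensional space). [cite: DxdyTopic80156, post 817605 (2014-01-21)] -/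
theorem eig2_inr_ne_one (n : ℕ) (b : Bool) : eig2 (Sum.inr (n, b)) ≠ 1 := by
  have := fifty_le_eig2_inr n b; intro h; rw [h] at this; norm_num at this

/-- `one_le_eig2` — coordinate computation for sup's 2014 `ℓ₂` countermodel to Otelbaev's Theorem 6.1 (all blocks at once, one fixed infinite-dimensional space). [cite: DxdyTopic80156, post 817605 (2014-01-21)] -/
theorem one_le_eig2 (i : Idx) : 1 ≤ eig2 i := by
  rcases i with k | ⟨n, b⟩
  · simp [eig2]
  · linarith [fifty_le_eig2_inr n b]

/-- `eig2_f_ne_t` — coordinate computation for sup's 2014 `ℓ₂` countermodel to Otelbaev's Theorem 6.1 (all blocks at once, one fixed infinite-dimensional space). [cite: DxdyTopic80156, post 817605 (2014-01-21)] -/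
theorem eig2_f_ne_t (n m : ℕ) : eig2 (Sum.inr (n, false)) ≠ eig2 (Sum.inr (m, true)) := by
  rw [eig2_f, eig2_t]
  intro h
  have h' : (50 + 2 * n : ℝ) = 51 + 2 * m := h
  have : (2 * (n : ℤ) : ℤ) = 1 + 2 * m := by exact_mod_cast (by linarith : (2 * n : ℝ) = 1 + 2 * m)
  omega

/-- `L` as a bilinear map `ℓ² →ₗ ℓ² →ₗ ℓ²`. [folklore] -/
def Lmap : H2 →ₗ[ℝ] H2 →ₗ[ℝ] H2 :=
  LinearMap.mk₂ ℝ Lvec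
    (fun u u' v => by
      apply lp.ext; funext i
      rcases i with k | ⟨n, b⟩
      · simp [Lvec_inl]
      · simp only [lp.coeFn_add, Pi.add_apply, Lvec_inr, coef]; ring)
    (fun c u v => by
      apply lp.ext; funext i
      rcases i with k | ⟨n, b⟩
      · simp [Lvec_inl]
      · simp only [lp.coeFn_smul, Pi.smul_apply, Lvec_inr, coef, smul_eq_mul]; ring)
    (fun u v v' => by
      apply lp.ext; funext i
      rcases i with k | ⟨n, b⟩
      · simp [Lvec_inl]
      · simp only [lp.coeFn_add, Pi.add_apply, Lvec_inr, coef]; ring)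
    (fun c u v => by
      apply lp.ext; funext i
      rcases i with k | ⟨n, b⟩
      · simp [Lvec_inl]
      · simp only [lp.coeFn_smul, Pi.smul_apply, Lvec_inr, coef, smul_eq_mul]; ring)

/-- `Lmap_apply` — coordinate computation for sup's 2014 `ℓ₂` countermodel to Otelbaev's Theorem 6.1 (all blocks at once, one fixed infinite-dimensional space). [cite: DxdyTopic80156, post 817605 (2014-01-21)] -/
theorem Lmap_apply (u v : H2) (i : Idx) : Lmap u v i = Lfun u v i := rfl

/-- **The fixed infinite-dimensional instance** `(ℓ²(Idx), A, L)` as an `Otelbaev2013.Setting` — sup's 2014 `ℓ₂` countermodel (dxdy post 817605), all blocks at once. [folklore] -/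
def S2 : Setting Idx H2 where
  basis := stdBasis
  eig := eig2
  L := Lmap

/-- `S2_L` — coordinate computation for sup's 2014 `ℓ₂` countermodel to Otelbaev's Theorem 6.1 (all blocks at once, one fixed infinite-dimensional space). [cite: DxdyTopic80156, post 817605 (2014-01-21)] -/
theorem S2_L (u v : H2) (i : Idx) : S2.L u v i = Lfun u v i := rfl
/-- `S2_L_inl` — coordinate computation for sup's 2014 `ℓ₂` countermodel to Otelbaev's Theorem 6.1 (all blocks at once, one fixed infinite-dimensional space). [cite: DxdyTopic80156, post 817605 (2014-01-21)] -/
theorem S2_L_inl (u v : H2) (k : Fin 50) : S2.L u v (Sum.inl k) = 0 := rfl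
/-- `S2_L_inr` — coordinate computation for sup's 2014 `ℓ₂` countermodel to Otelbaev's Theorem 6.1 (all blocks at once, one fixed infinite-dimensional space). [cite: DxdyTopic80156, post 817605 (2014-01-21)] -/
theorem S2_L_inr (u v : H2) (n : ℕ) (b : Bool) : S2.L u v (Sum.inr (n, b)) = coef u v n := rfl

/-- `S2_basis_inner` — coordinate computation for sup's 2014 `ℓ₂` countermodel to Otelbaev's Theorem 6.1 (all blocks at once, one fixed infinite-dimensional space). [cite: DxdyTopic80156, post 817605 (2014-01-21)] -/
@[simp] theorem S2_basis_inner (i : Idx) (u : H2) : ⟪S2.basis i, u⟫ = u i := inner_stdBasis i u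

/-- `S2_eig` — coordinate computation for sup's 2014 `ℓ₂` countermodel to Otelbaev's Theorem 6.1 (all blocks at once, one fixed infinite-dimensional space). [cite: DxdyTopic80156, post 817605 (2014-01-21)] -/
theorem S2_eig : S2.eig = eig2 := rfl

/-! ### (У.3) -/

/-- `S2_y3` — coordinate computation for sup's 2014 `ℓ₂` countermodel to Otelbaev's Theorem 6.1 (all blocks at once, one fixed infinite-dimensional space). [cite: DxdyTopic80156, post 817605 (2014-01-21)] -/
theorem S2_y3 : S2.Y3 := by
  refine ⟨⟨Sum.inl 0, rfl⟩, fun i => one_le_eig2 i,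
    ⟨50, by norm_num, by norm_num, ⟨Sum.inr (0, false), by simp [S2_eig, eig2]⟩, ?_⟩, ?_, ?_⟩
  · intro i
    rcases i with k | ⟨n, b⟩
    · exact Or.inl rfl
    · exact Or.inr (fifty_le_eig2_inr n b)
  · refine ⟨fun k => Sum.inl ⟨k.val, by omega⟩, fun a b hab => ?_, fun k => rfl⟩
    have := Sum.inl.inj hab
    ext; simpa using congrArg Fin.val this
  · intro R
    -- eigenvalues ≤ R : 1 and 50+2n, 51+2n with n ≤ R: finite
    have hsub : range S2.eig ∩ Iic R ⊆
        insert 1 ((fun n : ℕ => (50 + 2 * n : ℝ)) '' {n | (n : ℝ) ≤ R} ∪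
          (fun n : ℕ => (51 + 2 * n : ℝ)) '' {n | (n : ℝ) ≤ R}) := by
      rintro x ⟨⟨i, rfl⟩, hx⟩
      rcases i with k | ⟨n, b⟩
      · exact mem_insert _ _
      · right
        have hx' : S2.eig (Sum.inr (n, b)) ≤ R := hx
        cases b
        · left; refine ⟨n, ?_, rfl⟩
          show (n : ℝ) ≤ R
          rw [S2_eig, eig2_f] at hx'; have : (0:ℝ) ≤ n := n.cast_nonneg; linarith
        · right; refine ⟨n, ?_, rfl⟩
          show (n : ℝ) ≤ R
          rw [S2_eig, eig2_t] at hx'; have : (0:ℝ) ≤ n := n.cast_nonneg; linarith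
    have hfin : {n : ℕ | (n : ℝ) ≤ R}.Finite := by
      refine (Set.finite_le_nat ⌈max R 0⌉₊).subset fun n hn => ?_
      have hn' : (n : ℝ) ≤ R := hn
      have h2 : (n : ℝ) ≤ (⌈max R 0⌉₊ : ℕ) := (hn'.trans (le_max_left _ _)).trans (Nat.le_ceil _)
      exact_mod_cast h2
    exact ((hfin.image _).union (hfin.image _)).insert 1 |>.subset hsub

/-! ### coordinate facts for `L` -/

/-- `L_eq_zero_of_f` — coordinate computation for sup's 2014 `ℓ₂` countermodel to Otelbaev's Theorem 6.1 (all blocks at once, one fixed infinite-dimensional space). [cite: DxdyTopic80156, post 817605 (2014-01-21)] -/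
theorem L_eq_zero_of_f (u v : H2) (h : ∀ n, u (Sum.inr (n, false)) = 0 ∨ v (Sum.inr (n, true)) = 0) :
    S2.L u v = 0 := by
  apply lp.ext; funext i
  rcases i with k | ⟨n, b⟩
  · rfl
  · rw [S2_L_inr, coef]
    rcases h n with h | h <;> simp [h]

/-- `inner_L` — coordinate computation for sup's 2014 `ℓ₂` countermodel to Otelbaev's Theorem 6.1 (all blocks at once, one fixed infinite-dimensional space). [cite: DxdyTopic80156, post 817605 (2014-01-21)] -/
theorem inner_L (u v g : H2) :
    ⟪S2.L u v, g⟫ = ∑' i, S2.L u v i * g i := by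
  rw [lp.inner_eq_tsum]
  congr 1; funext i
  rw [real_inner_comm]; rfl

/-- `inner_L_eq_zero` — coordinate computation for sup's 2014 `ℓ₂` countermodel to Otelbaev's Theorem 6.1 (all blocks at once, one fixed infinite-dimensional space). [cite: DxdyTopic80156, post 817605 (2014-01-21)] -/
theorem inner_L_eq_zero (u v g : H2) (hg : ∀ n b, g (Sum.inr (n, b)) = 0) : ⟪S2.L u v, g⟫ = 0 := by
  rw [inner_L]
  have : (fun i => S2.L u v i * g i) = fun _ => 0 := by
    funext i
    rcases i with k | ⟨n, b⟩
    · rw [S2_L_inl]; ring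
    · rw [hg n b]; ring
  rw [this, tsum_zero]

/-! ### (У.2) -/

/-- `S2_y2` — coordinate computation for sup's 2014 `ℓ₂` countermodel to Otelbaev's Theorem 6.1 (all blocks at once, one fixed infinite-dimensional space). [cite: DxdyTopic80156, post 817605 (2014-01-21)] -/
theorem S2_y2 : S2.Y2 := by
  intro u hu
  obtain ⟨lam, hlam⟩ := hu
  simp only [S2_basis_inner, S2_eig] at hlam
  -- claim: L u u = 0 (at most one of u_{n,f}, u_{n,t} is nonzero, since their eigenvalues differ)
  have hL : S2.L u u = 0 := by
    refine L_eq_zero_of_f u u fun n => ?_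
    by_contra h
    simp only [not_or] at h
    have h1 := hlam (Sum.inr (n, false)) h.1
    have h2 := hlam (Sum.inr (n, true)) h.2
    exact eig2_f_ne_t n n (h1.trans h2.symm)
  rw [hL, inner_zero_right]

/-! ### (У.4) -/

/-- `G1_coord` — coordinate computation for sup's 2014 `ℓ₂` countermodel to Otelbaev's Theorem 6.1 (all blocks at once, one fixed infinite-dimensional space). [cite: DxdyTopic80156, post 817605 (2014-01-21)] -/
theorem G1_coord {e : H2} (he : e ∈ S2.G1) (n : ℕ) (b : Bool) : e (Sum.inr (n, b)) = 0 := by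
  simp only [Setting.G1, Set.mem_setOf_eq, S2_basis_inner, S2_eig] at he
  by_contra h
  exact eig2_inr_ne_one n b (he _ h)

/-- `S2_y4` — coordinate computation for sup's 2014 `ℓ₂` countermodel to Otelbaev's Theorem 6.1 (all blocks at once, one fixed infinite-dimensional space). [cite: DxdyTopic80156, post 817605 (2014-01-21)] -/
theorem S2_y4 : S2.Y4 := by
  intro e he u
  have hz := G1_coord he
  have hLeu : S2.L e u = 0 := L_eq_zero_of_f e u fun n => Or.inl (hz n false)
  have hLue : S2.L u e = 0 := L_eq_zero_of_f u e fun n => Or.inr (hz n true)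
  refine ⟨hLeu, hLue, ?_, ?_, ?_, ?_⟩
  · simp [Setting.Lsym, hLeu, hLue]
  · intro g
    simp only [Setting.Lsym, inner_add_left, inner_L_eq_zero _ _ e hz, add_zero]
  · simp [Setting.Lsym, hLeu, hLue]
  · intro g
    have h1 : S2.L e g = 0 := L_eq_zero_of_f e g fun n => Or.inl (hz n false)
    have h2 : S2.L g e = 0 := L_eq_zero_of_f g e fun n => Or.inr (hz n true)
    simp [Setting.Lsym, h1, h2]

/-! ### (У.5) -/

/-- `proj_coord` — coordinate computation for sup's 2014 `ℓ₂` countermodel to Otelbaev's Theorem 6.1 (all blocks at once, one fixed infinite-dimensional space). [cite: DxdyTopic80156, post 817605 (2014-01-21)] -/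
theorem proj_coord {P : H2 →ₗ[ℝ] H2} (hP : S2.IsProjG1 P) (u : H2) (i : Idx) :
    (P u) i = if eig2 i = 1 then u i else 0 := by
  simpa [S2_basis_inner, S2_eig] using hP u i

/-- `proj_inr` — coordinate computation for sup's 2014 `ℓ₂` countermodel to Otelbaev's Theorem 6.1 (all blocks at once, one fixed infinite-dimensional space). [cite: DxdyTopic80156, post 817605 (2014-01-21)] -/
theorem proj_inr {P : H2 →ₗ[ℝ] H2} (hP : S2.IsProjG1 P) (u : H2) (n : ℕ) (b : Bool) :
    (P u) (Sum.inr (n, b)) = 0 := by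
  rw [proj_coord hP, if_neg (eig2_inr_ne_one n b)]

/-- `proj_L_eq_zero` — coordinate computation for sup's 2014 `ℓ₂` countermodel to Otelbaev's Theorem 6.1 (all blocks at once, one fixed infinite-dimensional space). [cite: DxdyTopic80156, post 817605 (2014-01-21)] -/
theorem proj_L_eq_zero {P : H2 →ₗ[ℝ] H2} (hP : S2.IsProjG1 P) (u v : H2) : P (S2.L u v) = 0 := by
  apply lp.ext; funext i
  rw [proj_coord hP]
  rcases i with k | ⟨n, b⟩
  · simp [S2_L_inl]
  · rw [if_neg (eig2_inr_ne_one n b)]; rfl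

/-- `LP_eq_zero` — coordinate computation for sup's 2014 `ℓ₂` countermodel to Otelbaev's Theorem 6.1 (all blocks at once, one fixed infinite-dimensional space). [cite: DxdyTopic80156, post 817605 (2014-01-21)] -/
theorem LP_eq_zero {P : H2 →ₗ[ℝ] H2} (hP : S2.IsProjG1 P) (u : H2) : S2.LP P u u = 0 := by
  have h1 : S2.L (P u) u = 0 := L_eq_zero_of_f _ _ fun n => Or.inl (proj_inr hP u n false)
  have h2 : S2.L u (P u) = 0 := L_eq_zero_of_f _ _ fun n => Or.inr (proj_inr hP u n true)
  have h3 : S2.L (P u) (P u) = 0 := L_eq_zero_of_f _ _ fun n => Or.inl (proj_inr hP u n false)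
  simp [Setting.LP, h1, h2, h3, proj_L_eq_zero hP]

/-- `S2_y5` — coordinate computation for sup's 2014 `ℓ₂` countermodel to Otelbaev's Theorem 6.1 (all blocks at once, one fixed infinite-dimensional space). [cite: DxdyTopic80156, post 817605 (2014-01-21)] -/
theorem S2_y5 {n' CP : ℝ} (hn' : 0 ≤ n') (hCP : 0 < CP) : S2.Y5 n' CP := by
  refine ⟨hn', hCP, fun P hP u => ?_⟩
  rw [LP_eq_zero hP, norm_zero]
  have : 0 ≤ ‖S2.nl u‖ ^ n' := Real.rpow_nonneg (norm_nonneg _) _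
  positivity


end AbstractAPrioriEstimateDirectSumPerSpace

end Literature.Barriers.NavierStokesRegularity

end
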